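/- Copyright: ym-fleet seat `ym-infvol-p3` (prover, g4), for crux `HistoryTail` (stmt-QuantumFields-18916) of route
`UnitScaleTilt`, STUB 3 «chessboard ∕ reflection positivity» of the v5′ skeleton.  Released under the licence of the
surrounding project. -/
import Summits.QuantumFields.BalabanUV.T4Continuum.Support.HistoryChessboardEventsCubeSites
import Summits.QuantumFields.BalabanUV.T4Continuum.Support.HistoryChessboardPlaquetteBox
import Summits.QuantumFields.BalabanUV.T4Continuum.Support.HistoryChessboardTowerRepr
import HarnessLib

/-!
# Chessboard for ONE top-level plaquette of the Gibbs tower, file 1: reading the TOP FIELD at a cube cut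

Support file (helper lemmas, `--supports stmt-QuantumFields-18916`) for STUB 3 `stub_chessboardRP` of the v5′ birth
skeleton of crux `HistoryTail` (route `UnitScaleTilt`, Bałaban's 3-d unit-scale tilt): «the chessboard estimate for ONE
averaged-plaquette event».  Everything here is bookkeeping over the T⁴ cell's «History chessboard road»
(`Summits/QuantumFields/BalabanUV/T4Continuum/Support/HistoryRP*`, `HistoryChessboard*`), which is written for a general
`P : Params` (any dimension `P.d`) and therefore serves the 3-d family verbatim:

* the TOWER `Tower P G K` of the averaged fields `(U, Ū, …, Ū^K)` and its law `towerLaw μ av K`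
  (`HistoryRPTowerLaw`), the cut reflections `cutRefl K i κ` ∕ positive algebras `cutPos G K i κ` at every unit
  hyperplane of the top lattice (`HistoryRPTowerCuts`), re-indexed by CUBE cuts `cubeCut h k`
  (`h : sitesPerDir K = M·N`, cubes of side `M`, `N` per direction; `HistoryChessboardEventsCubes`);
* the five RP fields of the `SU(n)` Wilson–Gibbs tower of Bałaban's block averagings at every cube cut,
  `HistoryChessboardEventsCubes.cutoffRP_towerLaw_gibbs_SU_cubes` (Osterwalder–Seiler reflection positivity transported +
  the two-block locality ∕ centre-equivariance ∕ block-translation covariance of `blockAvg`).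

WHAT (this file, general `P`, any group): §1 the top field `last K` under a cut reflection — `last_cutRefl`, and on the
`dist1` of a plaquette variable `dist1_plaqHol_last_cutRefl` with the CUT-REFLECTED PLAQUETTE `cutPlaq K i κ p`
(the conjugate of `HistoryChessboardPlaquetteBox.cplaq` by the cut translation; its labels `cutPlaq_src_apply_same ∕
_of_ne`, involutive); §2 the top field is measurable for the cut's positive algebra (`measurable_last_cutPos`), hence so
is every top-level bond variable positive for the cut (`measurable_last_coord_cutPos`) and the `dist1` of every top
plaquette whose four letters are positive (`measurable_dist1_plaqHol_last_cutPos`); §3 the same in CUBE letters: for a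
cube `c` of the positive half `halfPlus N i k` and a top plaquette with its four corners in `c`, the
`dist1` of its variable is `cubePos h i k`-measurable (`measurable_dist1_plaqHol_last_cubePos`), and `cubeRefl h i k`
acts on it through `cutPlaq K i (cubeCut h k)` (`dist1_plaqHol_last_cubeRefl`).

HONEST SCOPE.  Finite-torus symmetry ∕ measurability bookkeeping over tree theorems; no estimate of Bałaban's papers is
used or asserted; the crux `HistoryTail` and its route are CONDITIONAL on the (α) input package and are not advanced by
this file beyond STUB 3's reflection-positivity plumbing.  Not infinite volume, not a gap, not Clay.
-/

namespace Summit.QuantumFields.YangMills.Theorems.HistoryTailChessboardTopField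

open MeasureTheory
open Literature.Barriers.CriticalPhenomena.NonGibbs
open Literature.MathematicalPhysics.QuantumFieldTheory.Balaban1983to89
open Summit.QuantumFields.BalabanUV.T4Continuum
open HistoryRPHalfTorus HistoryRPTowerLaw HistoryRPTowerCuts HistoryRPTowerCells HistoryRPTowerColumns
open HistoryChessboardEventsCubes HistoryChessboardEventsCubeSites HistoryChessboardPlaquetteBox

noncomputable section

variable {P : Params} {G : Type*}

/-! ## §1 The top field under a cut reflection; the cut-reflected plaquette -/

section TopField

variable [GaugeGroup G] {K : ℕ}

/-- The top field of the cut-reflected tower point is the conjugated centre reflection of the top field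
(`last_towerTranslate`, `last_towerRefl`). [folklore] -/
theorem last_cutRefl (i : Fin P.d) (κ : ZMod (P.sitesPerDir K)) (ω : Tower P G K) :
    last K (cutRefl K i κ ω) =
      ((GaugeField.translate (cutVec K i κ) (last K ω)).creflect i).translate (-cutVec K i κ) := by
  unfold cutRefl
  rw [last_towerTranslate, last_towerRefl, last_towerTranslate]

/-- … evaluated at a top bond: the cut reflection reads the bond variable at `cutBond`, inverted on `i`-bonds.
[folklore] -/
theorem last_cutRefl_apply (i : Fin P.d) (κ : ZMod (P.sitesPerDir K)) (ω : Tower P G K) (b : PBond P K) :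
    last K (cutRefl K i κ ω) b =
      if b.dir = i then (last K ω (cutBond i (cutVec K i κ) b))⁻¹ else last K ω (cutBond i (cutVec K i κ) b) := by
  rw [last_cutRefl, translate_creflect_translate_apply]

variable (K) in
/-- **THE CUT-REFLECTED PLAQUETTE**: the centre-reflected plaquette `cplaq` conjugated by the cut translation `κ·e_i`
(the top plaquette at which the cut reflection `cutRefl K i κ` reads the `dist1` of a plaquette variable). -/
def cutPlaq (i : Fin P.d) (κ : ZMod (P.sitesPerDir K)) (p : Plaq P K) : Plaq P K :=
  (cplaq i (p.translate (-cutVec K i κ))).translate (cutVec K i κ)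

/-- directions of `cutPlaq`. [folklore] -/
@[simp] theorem cutPlaq_μ (i : Fin P.d) (κ : ZMod (P.sitesPerDir K)) (p : Plaq P K) : (cutPlaq K i κ p).μ = p.μ := rfl

/-- directions of `cutPlaq`. [folklore] -/
@[simp] theorem cutPlaq_ν (i : Fin P.d) (κ : ZMod (P.sitesPerDir K)) (p : Plaq P K) : (cutPlaq K i κ p).ν = p.ν := rfl

/-- the `i`-label of the base point of the cut-reflected plaquette: `2κ − 1 − x_i`, lowered by one more step when `i`
is a direction of `p`. [folklore] -/
theorem cutPlaq_src_apply_same (i : Fin P.d) (κ : ZMod (P.sitesPerDir K)) (p : Plaq P K) :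
    (cutPlaq K i κ p).src i = 2 * κ - 1 - p.src i - (if p.μ = i ∨ p.ν = i then 1 else 0) := by
  unfold cutPlaq
  show (cplaq i (p.translate (-cutVec K i κ))).src i + cutVec K i κ i = _
  rw [cplaq_src_apply_same]
  show -((p.src + -cutVec K i κ) i) - 1 - (if p.μ = i ∨ p.ν = i then (1 : ZMod (P.sitesPerDir K)) else 0) +
      cutVec K i κ i = _
  rw [Site.add_apply, neg_apply', cutVec_apply_same]
  ring

/-- the other labels of the base point of the cut-reflected plaquette are those of `p`. [folklore] -/
theorem cutPlaq_src_apply_of_ne (i : Fin P.d) (κ : ZMod (P.sitesPerDir K)) (p : Plaq P K) {ν : Fin P.d}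
    (h : ν ≠ i) : (cutPlaq K i κ p).src ν = p.src ν := by
  unfold cutPlaq
  show (cplaq i (p.translate (-cutVec K i κ))).src ν + cutVec K i κ ν = _
  rw [cplaq_src_apply_of_ne i _ h]
  show (p.src + -cutVec K i κ) ν + cutVec K i κ ν = _
  rw [Site.add_apply, neg_apply', cutVec_apply_of_ne i κ h]
  ring

/-- `cutPlaq` is an involution (`cplaq_cplaq`). [folklore] -/
theorem cutPlaq_cutPlaq (i : Fin P.d) (κ : ZMod (P.sitesPerDir K)) (p : Plaq P K) :
    cutPlaq K i κ (cutPlaq K i κ p) = p := by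
  unfold cutPlaq
  rw [plaq_translate_translate, add_neg_cancel, plaq_translate_zero, cplaq_cplaq, plaq_translate_translate,
    neg_add_cancel, plaq_translate_zero]

/-- **THE CUT REFLECTION ON THE `dist1` OF A TOP PLAQUETTE VARIABLE**:
`dist1 (Ū^K(cutRefl ω)(∂p)) = dist1 (Ū^K(ω)(∂(cutPlaq p)))` (`plaqHol_translate`, `dist1_plaqHol_creflect`). [folklore] -/
theorem dist1_plaqHol_last_cutRefl (i : Fin P.d) (κ : ZMod (P.sitesPerDir K)) (ω : Tower P G K) (p : Plaq P K) :
    dist1 (GaugeField.plaqHol (last K (cutRefl K i κ ω)) p) =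
      dist1 (GaugeField.plaqHol (last K ω) (cutPlaq K i κ p)) := by
  rw [last_cutRefl, GaugeField.plaqHol_translate, dist1_plaqHol_creflect, GaugeField.plaqHol_translate]
  rfl

end TopField

/-! ## §2 The top field is measurable for the cut's positive algebra -/

section Measurable

variable [MeasurableSpace G] {K : ℕ}

/-- **THE TOP FIELD IS POSITIVE-READABLE**: `last K` is measurable from the cut's positive algebra `cutPos G K i κ`
to the transported positive algebra `(mPos G K i).comap (translate (κ·e_i))` of the top level (`last` intertwines the
tower translation with the top translation, `last_towerTranslate`; `measurable_last_pos`). [folklore] -/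
theorem measurable_last_cutPos (i : Fin P.d) (κ : ZMod (P.sitesPerDir K)) :
    @Measurable _ _ (cutPos G K i κ) ((mPos G K i).comap (GaugeField.translate (cutVec K i κ)))
      (last (P := P) (G := G) K) := by
  refine measurable_comap_iff.2 ?_
  have e : (GaugeField.translate (cutVec K i κ) ∘ last (P := P) (G := G) K) =
      last K ∘ towerTranslate K (cutVec K i κ) := by
    funext ω
    simp only [Function.comp_apply, last_towerTranslate]
  rw [e]
  exact (measurable_last_pos i K).comp (comap_measurable (towerTranslate (G := G) K (cutVec K i κ)))

/-- **A TOP BOND VARIABLE POSITIVE FOR THE CUT IS `cutPos`-MEASURABLE** (`measurable_coord_of_translate_mem_posBonds`).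
[folklore] -/
theorem measurable_last_coord_cutPos (i : Fin P.d) (κ : ZMod (P.sitesPerDir K)) (b : PBond P K)
    (hb : b.translate (-cutVec K i κ) ∈ posBonds P K i) :
    Measurable[cutPos G K i κ] fun ω : Tower P G K => last K ω b :=
  (measurable_coord_of_translate_mem_posBonds (G := G) i (cutVec K i κ) b hb).comp (measurable_last_cutPos i κ)

variable [GaugeGroup G]

/-- **THE VARIABLE OF A TOP PLAQUETTE WITH POSITIVE LETTERS IS `cutPos`-MEASURABLE** (its four bond variables are,
and `G` has measurable multiplication ∕ inversion). [folklore] -/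
theorem measurable_plaqHol_last_cutPos [MeasurableMul₂ G] [MeasurableInv G] (i : Fin P.d)
    (κ : ZMod (P.sitesPerDir K)) (p : Plaq P K)
    (h1 : (⟨p.src, p.μ⟩ : PBond P K).translate (-cutVec K i κ) ∈ posBonds P K i)
    (h2 : (⟨p.src.shift p.μ, p.ν⟩ : PBond P K).translate (-cutVec K i κ) ∈ posBonds P K i)
    (h3 : (⟨p.src.shift p.ν, p.μ⟩ : PBond P K).translate (-cutVec K i κ) ∈ posBonds P K i)
    (h4 : (⟨p.src, p.ν⟩ : PBond P K).translate (-cutVec K i κ) ∈ posBonds P K i) :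
    Measurable[cutPos G K i κ] fun ω : Tower P G K => GaugeField.plaqHol (last K ω) p := by
  unfold GaugeField.plaqHol
  exact (((measurable_last_coord_cutPos i κ _ h1).mul (measurable_last_coord_cutPos i κ _ h2)).mul
    (measurable_last_coord_cutPos i κ _ h3).inv).mul (measurable_last_coord_cutPos i κ _ h4).inv

/-- … hence so is its `dist1` (`RegularGaugeGroup.measurable_dist1`). [folklore] -/
theorem measurable_dist1_plaqHol_last_cutPos [RegularGaugeGroup G] (i : Fin P.d) (κ : ZMod (P.sitesPerDir K))
    (p : Plaq P K)
    (h1 : (⟨p.src, p.μ⟩ : PBond P K).translate (-cutVec K i κ) ∈ posBonds P K i)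
    (h2 : (⟨p.src.shift p.μ, p.ν⟩ : PBond P K).translate (-cutVec K i κ) ∈ posBonds P K i)
    (h3 : (⟨p.src.shift p.ν, p.μ⟩ : PBond P K).translate (-cutVec K i κ) ∈ posBonds P K i)
    (h4 : (⟨p.src, p.ν⟩ : PBond P K).translate (-cutVec K i κ) ∈ posBonds P K i) :
    Measurable[cutPos G K i κ] fun ω : Tower P G K => dist1 (GaugeField.plaqHol (last K ω) p) :=
  RegularGaugeGroup.measurable_dist1.comp (measurable_plaqHol_last_cutPos i κ p h1 h2 h3 h4)

end Measurable

/-! ## §3 In cube letters: top plaquettes with their four corners in one cube -/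

section Cubes

variable {K M N : ℕ}

/-- the four letters of a plaquette with its four CORNERS in `S` (hypothesis spelled as the conjunction
`p.src ∈ S ∧ p.src + e_μ ∈ S ∧ p.src + e_ν ∈ S ∧ p.src + e_μ + e_ν ∈ S`) are links inside `S`. [folklore] -/
theorem letters_mem_links {S : Finset (Site P K)} {p : Plaq P K}
    (hp : p.src ∈ S ∧ p.src.shift p.μ ∈ S ∧ p.src.shift p.ν ∈ S ∧ (p.src.shift p.μ).shift p.ν ∈ S) :
    (⟨p.src, p.μ⟩ : PBond P K) ∈ links S ∧ (⟨p.src.shift p.μ, p.ν⟩ : PBond P K) ∈ links S ∧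
      (⟨p.src.shift p.ν, p.μ⟩ : PBond P K) ∈ links S ∧ (⟨p.src, p.ν⟩ : PBond P K) ∈ links S := by
  obtain ⟨h0, hμ, hν, hμν⟩ := hp
  refine ⟨mem_links.2 ⟨h0, hμ⟩, mem_links.2 ⟨hμ, hμν⟩, mem_links.2 ⟨hν, ?_⟩, mem_links.2 ⟨h0, hν⟩⟩
  show (p.src.shift p.ν).shift p.μ ∈ S
  rw [Site.shift_comm]
  exact hμν

variable [NeZero N] [MeasurableSpace G] [GaugeGroup G] [RegularGaugeGroup G]

/-- **`loc` FOR ONE TOP PLAQUETTE**: if the four corners of the top plaquette `p` lie in a cube `c` of the positive half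
`halfPlus N i k` of the cube torus (hypothesis spelled as a conjunction of the four memberships), the `dist1` of its variable on the top field is `cubePos h i k`-measurable
(`translate_neg_cutVec_mem_posBonds_of_cube` on the four letters). [folklore] -/
theorem measurable_dist1_plaqHol_last_cubePos (h : P.sitesPerDir K = M * N) {i : Fin P.d} {k : ZMod N}
    {c : BlockIdx P.d N} (hc : c ∈ halfPlus N i k) {p : Plaq P K}
    (hp : p.src ∈ cubeSites (K := K) M c ∧ p.src.shift p.μ ∈ cubeSites (K := K) M c ∧
      p.src.shift p.ν ∈ cubeSites (K := K) M c ∧ (p.src.shift p.μ).shift p.ν ∈ cubeSites (K := K) M c) :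
    Measurable[cubePos G h i k] fun ω : Tower P G K => dist1 (GaugeField.plaqHol (last K ω) p) := by
  obtain ⟨h1, h2, h3, h4⟩ := letters_mem_links hp
  exact measurable_dist1_plaqHol_last_cutPos i (cubeCut h k) p
    (translate_neg_cutVec_mem_posBonds_of_cube h hc h1) (translate_neg_cutVec_mem_posBonds_of_cube h hc h2)
    (translate_neg_cutVec_mem_posBonds_of_cube h hc h3) (translate_neg_cutVec_mem_posBonds_of_cube h hc h4)

omit [NeZero N] [MeasurableSpace G] [RegularGaugeGroup G] in
/-- **`sym` FOR ONE TOP PLAQUETTE, in cube letters**: the cube-cut reflection `cubeRefl h i k` acts on the `dist1` of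
the variable of a top plaquette `p` through the cut-reflected plaquette `cutPlaq K i (cubeCut h k) p`. [folklore] -/
theorem dist1_plaqHol_last_cubeRefl (h : P.sitesPerDir K = M * N) (i : Fin P.d) (k : ZMod N) (ω : Tower P G K)
    (p : Plaq P K) :
    dist1 (GaugeField.plaqHol (last K (cubeRefl h i k ω)) p) =
      dist1 (GaugeField.plaqHol (last K ω) (cutPlaq K i (cubeCut h k) p)) :=
  dist1_plaqHol_last_cutRefl i (cubeCut h k) ω p

end Cubes

end

end Summit.QuantumFields.YangMills.Theorems.HistoryTailChessboardTopField
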